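import Literature.Topology.FourManifolds.SchubertRegular
import Literature.Topology.FourManifolds.BandSumIsotopyRegularProofs
import HarnessLib

/-!
# Schubert's theorem for regular presentations: the exact upstream set

Topic `Literature/Topology/FourManifolds` (trunk T-4MAN). Sibling proof file of
`SchubertRegular.lean`, fact seat
`provefact-Literature.Topology.FourManifolds.Knot.Schubert1949_normalPosition_regular`
(Cromwell, *Knots and Links* (2004), §4.6, PDF p. 69: the oriented product
`L₁ # L₂ = (L₁ - a) ∪ (L₂ - c) ∪ b ∪ d` along a rectangular disc `R` with `|R ∩ S| =` one arc "is
independent of this choice so the product is uniquely defined" — asserted there without proof;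
H. Schubert (1949), Satz 3).

`SchubertRegular.lean` reduces the named fact
`Literature.Topology.FourManifolds.Knot.Schubert1949_normalPosition_regular` to the printed band
fact `BandData.isIsotopic_of_band_eq_of_isRegular` (`BandSumIsotopyRegular.lean`) and the geometric
heart `Knot.Schubert1949_normalPosition_rebuilt` (`SchubertNormalForm.lean`)
(`Schubert1949_normalPosition_regular_of_rebuilt`), and `BandSumIsotopyRegularProofs.lean` now
**proves** the band fact (`BandData.isIsotopic_of_band_eq_of_isRegular_holds`, the lifted-arc
construction). Feeding that theorem in, the present file records the resulting reductions, with
everything else proved: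

* `BandData.IsRegular.isIsotopic_rebuild` — a regular band sum of disjoint knots is isotopic to its
  rebuilt form (`BandData.rebuildData`: same band, same collar), unconditionally.
* `Knot.Schubert1949_normalPosition_rebuilt.normalPosition_regular :
    Schubert1949_normalPosition_rebuilt → Schubert1949_normalPosition_regular`.
* `Knot.Schubert1949_normalPosition_rebuilt.isRegularConnectedSum_isIsotopic :
    Schubert1949_normalPosition_rebuilt → schoenflies_exists_ball → IsRegularConnectedSum.isIsotopic`.

So the upstream set of `Schubert1949_normalPosition_regular` is exactly the single named fact
`Knot.Schubert1949_normalPosition_rebuilt`; its discharge `Schubert1949_normalPosition_regular_holds`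
is `Schubert1949_normalPosition_rebuilt_holds.normalPosition_regular`, once that exists. (An
earlier version of this file reduced the band input further to a 2-dimensional two-arc lemma;
that named fact was retired at the review of its decomposition (D-0026) once the lifted-arc proof
of the band fact made it unnecessary.)

## References

* P. R. Cromwell, *Knots and Links*, Cambridge University Press (2004), §4.6 (held:
  `book:cromwell2004-knots-links`, PDF p. 69). [Cromwell2004]
* H. Schubert, *Die eindeutige Zerlegbarkeit eines Knotens in Primknoten*, S.-B. Heidelberger
  Akad. Wiss. Math.-Nat. Kl. 1949, no. 3, 57–104 (not held). [Schubert1949]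
* R. E. Gompf, A. I. Stipsicz, *4-Manifolds and Kirby Calculus*, GSM 20, AMS (1999), §5.1.
  [GompfStipsicz1999]

## Design notes

* Only proved implications; no definition, no statement of another file is modified; no new named
  fact; nothing here uses `sorry`. No local notation (the sphere `𝕊 3` is spelled out), so that the
  file stays a pure proof file. The two reductions are dot-notation corollaries of the heart
  `Knot.Schubert1949_normalPosition_rebuilt` (usage `hR.normalPosition_regular`).
-/

open scoped Manifold ContDiff Topology Real
open Function Set Metric

noncomputable section

namespace Literature.Topology.FourManifolds

namespace BandData

variable {A B K : Knot}

/-- **A regular band sum of disjoint knots is isotopic to its rebuilt form**: `K` and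
`b.rebuild hAB` are band sums of `A`, `B` along the same regular band with the same collar width
(`BandData.rebuildData`, `SchubertNormalForm.lean`), so the proved printed band fact applies
(`BandData.isIsotopic_rebuild_of_isRegular` of `SchubertRegular.lean`, fed with
`BandData.isIsotopic_of_band_eq_of_isRegular_holds`). Gompf–Stipsicz (1999), §5.1; Cromwell
(2004), §4.6. [cite: Cromwell2004, §4.6 (PDF p. 69)] -/
theorem IsRegular.isIsotopic_rebuild {b : BandData A B K ∅} (h : b.IsRegular)
    (hAB : Disjoint (range A) (range B)) : K.IsIsotopic (b.rebuild hAB) :=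
  b.isIsotopic_rebuild_of_isRegular isIsotopic_of_band_eq_of_isRegular_holds hAB h

end BandData

namespace Knot

/-- **Schubert's theorem in normal position for regular presentations follows from the heart for
rebuilt presentations alone**: `K ≃ b.rebuild ≃ b'.rebuild ≃ K'`, the outer isotopies by the
proved band fact (`BandData.IsRegular.isIsotopic_rebuild`; the summands are disjoint because `A`
lies in the open northern and `B` in the open southern hemisphere), the middle one by the heart
`Knot.Schubert1949_normalPosition_rebuilt` (`SchubertNormalForm.lean`). This is
`Schubert1949_normalPosition_regular_of_rebuilt` (`SchubertRegular.lean`) with its band hypothesis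
discharged by `BandData.isIsotopic_of_band_eq_of_isRegular_holds`. Cromwell (2004), §4.6.
[cite: Cromwell2004, §4.6 (PDF p. 69)] -/
theorem Schubert1949_normalPosition_rebuilt.normalPosition_regular
    (hR : Schubert1949_normalPosition_rebuilt) : Schubert1949_normalPosition_regular :=
  Schubert1949_normalPosition_regular_of_rebuilt BandData.isIsotopic_of_band_eq_of_isRegular_holds hR

/-- **The connected sum of oriented knots (printed form) is well defined, reduced to two named
facts**: Schubert's theorem for rebuilt presentations in normal position (`hR`,
`Knot.Schubert1949_normalPosition_rebuilt`, `SchubertNormalForm.lean`) and the ball form of the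
smooth Schoenflies theorem in `𝕊³` (`hB`, Alexander (1924); `SchoenfliesSphereThree.lean`), the
printed band fact being proved (`BandData.isIsotopic_of_band_eq_of_isRegular_holds`). This is
`IsRegularConnectedSum.isIsotopic_of_ball_of_regular_band_eq_of_rebuilt` (`SchubertRegular.lean`)
with its band hypothesis discharged. Cromwell (2004), §4.6. [cite: Cromwell2004, §4.6 (PDF p. 69)] -/
theorem Schubert1949_normalPosition_rebuilt.isRegularConnectedSum_isIsotopic
    (hR : Schubert1949_normalPosition_rebuilt) (hB : SphereEmbedding.schoenflies_exists_ball) :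
    IsRegularConnectedSum.isIsotopic :=
  IsRegularConnectedSum.isIsotopic_of_ball_of_regular_band_eq_of_rebuilt hB
    BandData.isIsotopic_of_band_eq_of_isRegular_holds hR

end Knot

end Literature.Topology.FourManifolds
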